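import Literature.Probability.LatticeModels.SourcedDoubleCurrentsOneArmMoments
import Literature.Probability.LatticeModels.SourcelessConnectivity
import HarnessLib

/-!
# Disjoint-clusters (BK-type) inequality for the sourceless double random current
(route ArmHyperscaling, crux `MergingFloor`, item stmt-CriticalPhenomena-15592, line
`xor-cluster-sign-bk`, registered stub `stub_disjointClustersBK`)

Statement (`stub_disjointClustersBK`): for the sourceless double random current of the free box
`Λ_L ⊂ ℤ^d` at `β ≥ 0` (the tree's `sourcedDoubleCurrentLaw d L β ∅ ∅`, the law of the trace
`n̂₁ ∪ n̂₂` of two independent sourceless currents of the free box graph) and four points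
`a, b, c, e ∈ Λ_L`,

  `P^{∅,∅}_{Λ_L,β}[a ↔ c, b ↔ e, a ↮ b] ≤ ⟨σ_aσ_c⟩²_{Λ_L,β} · ⟨σ_bσ_e⟩²_{Λ_L,β}`

(free boundary condition).  In the line this bounds the two crossed-pairing terms of `P[𝓕_S]`.

Proof.  Everything happens on the finite free box graph `G = freeBoxGraph d L` with `ℝ≥0∞`
current sums `Z[A] = ecurrentSum K A`, `K ≡ β` (`WeightedCurrents.lean`); the core is the
current-sum inequality `tsum_epairWeight_sep_conn_mul_sq_le`, valid for arbitrary couplings `K ≥ 0`: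

  `(∑ 1{∂n₁=∅}1{∂n₂=∅} w w 𝟙[c ∈ C(a)] 𝟙[b ∉ C(a)] 𝟙[e ∈ C(b)]) · Z[∅]² ≤ Z[ac]² Z[be]²`,

`C(·) = C_{n₁+n₂}(·)`.  (1) *Switching* (`Current.tsum_epairWeight_switch_pair`, the functional
`F = 𝟙[c ∈ C(a)] 𝟙[b ∉ C(a)]` depends on `n₁ + n₂` only): the connection `b ↔ e` of the sourceless
pair is traded for sources, `∑_{∅,∅} w w F 𝟙[e ∈ C(b)] = ∑_{be,be} w w F`.  (2) *Peeling the
cluster of `a`* — Aizenman–Duminil-Copin 2021, Lemma A.1, twice (tree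
`Current.ecurrentSum_empty_mul_tsum_epairWeight_pair_le`,
`Current.tsum_epairWeight_eq_tsum_mul_offRatio_left`): `F` is a function of the cluster `C(a)`
alone, hence local, and on `{F ≠ 0}` the cluster `C(a)` avoids `b`, hence (as `b ↔ e` inside
each current with sources `{b,e}`) avoids `{b,e}`; conditionally on `C(a) = C` the currents off `C`
are free currents of the graph with `C` deleted, whose normalised `{b,e}`-sourced mass is the
restricted correlation `⟨σ_bσ_e⟩_{Λ∖C} ≤ ⟨σ_bσ_e⟩_Λ = Z[be]/Z[∅]` (Griffiths, tree
`Current.offRatio_pair_mul_le`).  This removes the sources `{b,e}` of the second and then of the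
first current at the cost of a factor `Z[be]/Z[∅]` each: `Z[∅]² ∑_{be,be} w w F ≤ Z[be]² ∑_{∅,∅} w w F`.
(3) *Resummation*: `∑_{∅,∅} w w F ≤ ∑_{∅,∅} w w 𝟙[c ∈ C(a)] = Z[ac]²` (switching lemma for two
sourceless currents, tree `Current.tsum_epairWeight_empty_empty_mul_connInd`).  The normalised
finite-graph form `doubleCurrentMeasure_real_sepConn_le` divides by `Z[∅]⁴`
(`doubleCurrentMeasure_apply_eq_tsum_epairWeight_div`, `⟨σ_xσ_y⟩ = Z[xy]/Z[∅]`), and the box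
statement is its transport along the lifted trace (`sourcedDoubleCurrentLaw_apply`,
`sourcedTrace_preimage_openConn`, `isingTwoPoint_free_box_eq_boxGraph`).  Degenerate cases need no
separate treatment.

References: M. Aizenman, H. Duminil-Copin, Ann. of Math. 194 (2021), arXiv:1912.07973,
Appendix A.1, Lemma A.1 (partial monotonicity / conditioning on a cluster) and §6.2, (6.12)
(sourceless connection `≤ ⟨σσ⟩²`); M. Aizenman, Comm. Math. Phys. 86 (1982), §5 (conditioning on
clusters); J. van den Berg, H. Kesten, J. Appl. Probab. 22 (1985) (the disjoint-occurrence
paradigm).  No definitions and no named facts are introduced.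
-/

noncomputable section

namespace Summit.CriticalPhenomena.Ising3DConformalLimit.ArmHyperscalingMergingFloorXor

open Literature.Probability.LatticeModels Literature.Probability.Percolation MeasureTheory
open scoped symmDiff ENNReal

section Core

variable {V : Type*} [Fintype V] [DecidableEq V] {G : SimpleGraph V} [DecidableRel G.Adj]
  {K : G.edgeFinset → ℝ}

/-- **Disjoint clusters, current-sum form** (finite graph, couplings `K ≥ 0`): with
`C(·) = C_{n₁+n₂}(·)`,
`(∑ 1{∂n₁=∅}1{∂n₂=∅} w w 𝟙[c ∈ C(a)] 𝟙[b ∉ C(a)] 𝟙[e ∈ C(b)]) · Z[∅]² ≤ Z[{a}∆{c}]² · Z[{b}∆{e}]²`,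
i.e. `P^{∅,∅}[a ↔ c, b ↔ e, a ↮ b] ≤ ⟨σ_aσ_c⟩²⟨σ_bσ_e⟩²`.  Switching `b ↔ e` into sources `{b,e}`
of both currents, Aizenman–Duminil-Copin's Lemma A.1 twice at the cluster of `a` with Griffiths'
bound on the restricted correlation, and the sourceless switching identity for `a ↔ c`.
(Aizenman–Duminil-Copin 2021, Appendix A.1, Lemma A.1; §6.2, (6.12).) -/
theorem tsum_epairWeight_sep_conn_mul_sq_le (hK : ∀ e, 0 ≤ K e) (a b c e : V) :
    (∑' p : Current G × Current G, epairWeight K ∅ ∅ p *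
        ((if c ∈ (p.1 + p.2).cluster a then 1 else 0) * (if b ∈ (p.1 + p.2).cluster a then 0 else 1) *
          (if e ∈ (p.1 + p.2).cluster b then 1 else 0))) * ecurrentSum K ∅ ^ 2 ≤
      ecurrentSum K ({a} ∆ {c}) ^ 2 * ecurrentSum K ({b} ∆ {e}) ^ 2 := by
  classical
  -- the cluster functional `F = 𝟙[c ∈ C(a)] 𝟙[b ∉ C(a)]` of the sum current, and on pairs (kept
  -- opaque: all uses go through the defining equations)
  obtain ⟨F, hFdef⟩ : ∃ F : Current G → ℝ≥0∞,
      F = fun n => (if c ∈ n.cluster a then 1 else 0) * (if b ∈ n.cluster a then 0 else 1) := ⟨_, rfl⟩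
  obtain ⟨Φ, hΦdef⟩ : ∃ Φ : Current G × Current G → ℝ≥0∞, Φ = fun p => F (p.1 + p.2) := ⟨_, rfl⟩
  have hF0 : ∀ n : Current G, F n ≠ 0 → b ∉ n.cluster a := by
    intro n hn hb
    apply hn
    simp only [hFdef, if_pos hb, mul_zero]
  have hΦ0 : ∀ n₁ n₂ : Current G, Φ (n₁, n₂) ≠ 0 → b ∉ (n₁ + n₂).cluster a := by
    intro n₁ n₂ h
    apply hF0
    simpa only [hΦdef] using h
  -- (1) switching `b ↔ e` into sources `{b,e}`, `{b,e}`
  have h1 : ∑' p : Current G × Current G, epairWeight K ∅ ∅ p *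
        ((if c ∈ (p.1 + p.2).cluster a then 1 else 0) * (if b ∈ (p.1 + p.2).cluster a then 0 else 1) *
          (if e ∈ (p.1 + p.2).cluster b then 1 else 0)) =
      ∑' p : Current G × Current G, epairWeight K ({b} ∆ {e}) ({b} ∆ {e}) p * Φ p := by
    have h := Current.tsum_epairWeight_switch_pair hK ∅ b e F
    rw [Current.empty_symmDiff] at h
    rw [hΦdef, h, hFdef]
  -- (2a) Lemma A.1 at the cluster of `a`: remove the sources of the second current
  have hloc : ∀ n₁ n₂ n₂' : Current G,
      (∀ e' : G.edgeFinset, ¬ Current.EdgeOff ((n₁ + n₂).cluster a) (e' : Sym2 V) → n₂' e' = n₂ e') →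
      Φ (n₁, n₂') = Φ (n₁, n₂) := fun n₁ n₂ n₂' h => by
    simp only [hΦdef, hFdef, Current.cluster_add_congr_right h]
  have hvan : ∀ n₁ n₂ : Current G, n₁.sources = {b} ∆ {e} → n₂.sources = {b} ∆ {e} →
      Φ (n₁, n₂) ≠ 0 → Disjoint ((n₁ + n₂).cluster a) ({b} ∆ {e}) := fun n₁ n₂ _ h₂ hne => by
    have hb : b ∉ (n₁ + n₂).cluster a := hΦ0 n₁ n₂ hne
    rw [symmDiff_comm] at h₂ ⊢
    exact Current.disjoint_cluster_of_sources_eq_right h₂ hb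
  have h2 : ecurrentSum K ∅ * ∑' p : Current G × Current G, epairWeight K ({b} ∆ {e}) ({b} ∆ {e}) p * Φ p ≤
      ecurrentSum K ({b} ∆ {e}) * ∑' p : Current G × Current G, epairWeight K ({b} ∆ {e}) ∅ p * Φ p :=
    Current.ecurrentSum_empty_mul_tsum_epairWeight_pair_le hK a ({b} ∆ {e}) b e Φ hloc hvan
  -- (2b) Lemma A.1 at the cluster of `a`: remove the sources of the first current
  have hloc' : ∀ n₁ n₁' n₂ : Current G,
      (∀ e' : G.edgeFinset, ¬ Current.EdgeOff ((n₁ + n₂).cluster a) (e' : Sym2 V) → n₁' e' = n₁ e') →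
      Φ (n₁', n₂) = Φ (n₁, n₂) := fun n₁ n₁' n₂ h => by
    simp only [hΦdef, hFdef, Current.cluster_add_congr_left h]
  have hvan' : ∀ n₁ n₂ : Current G, n₁.sources = {b} ∆ {e} → n₂.sources = ∅ →
      Φ (n₁, n₂) ≠ 0 → Disjoint ((n₁ + n₂).cluster a) ({b} ∆ {e}) := fun n₁ n₂ h₁ _ hne => by
    have hb : b ∉ (n₁ + n₂).cluster a := hΦ0 n₁ n₂ hne
    rw [symmDiff_comm] at h₁ ⊢
    exact Current.disjoint_cluster_of_sources_eq_left h₁ hb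
  have h3 : ecurrentSum K ∅ * ∑' p : Current G × Current G, epairWeight K ({b} ∆ {e}) ∅ p * Φ p ≤
      ecurrentSum K ({b} ∆ {e}) * ∑' p : Current G × Current G, epairWeight K ∅ ∅ p * Φ p := by
    rw [Current.tsum_epairWeight_eq_tsum_mul_offRatio_left hK a ({b} ∆ {e}) ∅ Φ hloc' hvan',
      ← ENNReal.tsum_mul_left, ← ENNReal.tsum_mul_left]
    refine ENNReal.tsum_le_tsum fun p => ?_
    calc ecurrentSum K ∅ * (epairWeight K ∅ ∅ p *
          (Φ p * Current.offRatio K ((p.1 + p.2).cluster a) ({b} ∆ {e})))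
        = epairWeight K ∅ ∅ p * Φ p *
            (Current.offRatio K ((p.1 + p.2).cluster a) ({b} ∆ {e}) * ecurrentSum K ∅) := by ring
      _ ≤ epairWeight K ∅ ∅ p * Φ p * ecurrentSum K ({b} ∆ {e}) :=
          mul_le_mul' le_rfl (Current.offRatio_pair_mul_le hK _ b e)
      _ = ecurrentSum K ({b} ∆ {e}) * (epairWeight K ∅ ∅ p * Φ p) := by ring
  -- (3) resummation: `∑_{∅,∅} w w F ≤ ∑_{∅,∅} w w 𝟙[c ∈ C(a)] = Z[ac]²`
  have h4 : ∑' p : Current G × Current G, epairWeight K ∅ ∅ p * Φ p ≤ ecurrentSum K ({a} ∆ {c}) ^ 2 := by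
    rw [← Current.tsum_epairWeight_empty_empty_mul_connInd hK a c]
    refine ENNReal.tsum_le_tsum fun p => mul_le_mul' le_rfl ?_
    simp only [hΦdef, hFdef, Current.connInd]
    split_ifs <;> simp
  -- assembly
  calc (∑' p : Current G × Current G, epairWeight K ∅ ∅ p *
        ((if c ∈ (p.1 + p.2).cluster a then 1 else 0) * (if b ∈ (p.1 + p.2).cluster a then 0 else 1) *
          (if e ∈ (p.1 + p.2).cluster b then 1 else 0))) * ecurrentSum K ∅ ^ 2
      = ecurrentSum K ∅ * (ecurrentSum K ∅ *
          ∑' p : Current G × Current G, epairWeight K ({b} ∆ {e}) ({b} ∆ {e}) p * Φ p) := by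
        rw [h1]; ring
    _ ≤ ecurrentSum K ∅ * (ecurrentSum K ({b} ∆ {e}) *
          ∑' p : Current G × Current G, epairWeight K ({b} ∆ {e}) ∅ p * Φ p) :=
        mul_le_mul' le_rfl h2
    _ = ecurrentSum K ({b} ∆ {e}) * (ecurrentSum K ∅ *
          ∑' p : Current G × Current G, epairWeight K ({b} ∆ {e}) ∅ p * Φ p) := by ring
    _ ≤ ecurrentSum K ({b} ∆ {e}) * (ecurrentSum K ({b} ∆ {e}) *
          ∑' p : Current G × Current G, epairWeight K ∅ ∅ p * Φ p) :=
        mul_le_mul' le_rfl h3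
    _ ≤ ecurrentSum K ({b} ∆ {e}) * (ecurrentSum K ({b} ∆ {e}) * ecurrentSum K ({a} ∆ {c}) ^ 2) :=
        mul_le_mul' le_rfl (mul_le_mul' le_rfl h4)
    _ = ecurrentSum K ({a} ∆ {c}) ^ 2 * ecurrentSum K ({b} ∆ {e}) ^ 2 := by ring

/-- **Disjoint clusters for the sourceless double current of a finite graph** (normalised form,
uniform coupling `β ≥ 0`): `P^{∅,∅}_{G,β}[a ↔ c, b ↔ e, a ↮ b] ≤ ⟨σ_aσ_c⟩²_G · ⟨σ_bσ_e⟩²_G` for the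
free Ising state of `G` — `tsum_epairWeight_sep_conn_mul_sq_le` divided by `Z[∅]⁴`
(`P^{∅,∅}[S] = (∑ w w 𝟙_S)/Z[∅]²`, `⟨σ_xσ_y⟩ = Z[xy]/Z[∅]`).
(Aizenman–Duminil-Copin 2021, Appendix A.1, Lemma A.1; §6.2, (6.12).) -/
theorem doubleCurrentMeasure_real_sepConn_le (G : SimpleGraph V) [DecidableRel G.Adj] {β : ℝ}
    (hβ : 0 ≤ β) (a b c e : V) :
    (doubleCurrentMeasure G β ∅ ∅).real (tracedConn G a c ∩ tracedConn G b e ∩ (tracedConn G a b)ᶜ) ≤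
      isingTwoPoint G Finset.univ β 0 .free a c ^ 2 * isingTwoPoint G Finset.univ β 0 .free b e ^ 2 := by
  classical
  have hK : ∀ e' : G.edgeFinset, 0 ≤ (fun _ : G.edgeFinset => β) e' := fun _ => hβ
  have hZ0 : currentSum G β ∅ ≠ 0 := (currentSum_empty_pos' G β).ne'
  set S : Set (Current G × Current G) := tracedConn G a c ∩ tracedConn G b e ∩ (tracedConn G a b)ᶜ
    with hSdef
  rw [measureReal_def, doubleCurrentMeasure_apply_eq_tsum_epairWeight_div G β hβ ∅ ∅ hZ0 hZ0 S,
    isingTwoPoint_free_eq_currentSum_div_holds G β a c, isingTwoPoint_free_eq_currentSum_div_holds G β b e,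
    currentSum_eq_wcurrentSum, currentSum_eq_wcurrentSum, currentSum_eq_wcurrentSum,
    ← toReal_ecurrentSum hK, ← toReal_ecurrentSum hK, ← toReal_ecurrentSum hK]
  -- the indicator of `S` as the product of three cluster indicators
  have hind : ∀ p : Current G × Current G, S.indicator (1 : Current G × Current G → ℝ≥0∞) p =
      (if c ∈ (p.1 + p.2).cluster a then 1 else 0) * (if b ∈ (p.1 + p.2).cluster a then 0 else 1) *
        (if e ∈ (p.1 + p.2).cluster b then 1 else 0) := by
    intro p
    simp only [hSdef, Set.indicator_apply, Set.mem_inter_iff, Set.mem_compl_iff, mem_tracedConn_iff,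
      Current.mem_cluster_iff, Pi.one_apply]
    by_cases h₁ : (openGraph (p.1 + p.2).traced).Reachable a c <;>
      by_cases h₂ : (openGraph (p.1 + p.2).traced).Reachable a b <;>
      by_cases h₃ : (openGraph (p.1 + p.2).traced).Reachable b e <;>
      simp [h₁, h₂, h₃]
  simp_rw [hind]
  -- finiteness and the real form of the core inequality
  have key := tsum_epairWeight_sep_conn_mul_sq_le hK a b c e
  set M : ℝ≥0∞ := ∑' p : Current G × Current G, epairWeight (fun _ : G.edgeFinset => β) ∅ ∅ p *
      ((if c ∈ (p.1 + p.2).cluster a then 1 else 0) * (if b ∈ (p.1 + p.2).cluster a then 0 else 1) *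
        (if e ∈ (p.1 + p.2).cluster b then 1 else 0)) with hMdef
  have hZtop : ∀ A : Finset V, ecurrentSum (fun _ : G.edgeFinset => β) A ≠ ∞ :=
    fun A => ecurrentSum_ne_top hK A
  have hMle : M ≤ ecurrentSum (fun _ : G.edgeFinset => β) ∅ * ecurrentSum (fun _ : G.edgeFinset => β) ∅ :=
    Current.tsum_epairWeight_mul_le ∅ ∅ fun p => by split_ifs <;> simp
  have hMtop : M ≠ ∞ := ne_top_of_le_ne_top (ENNReal.mul_ne_top (hZtop ∅) (hZtop ∅)) hMle
  have hr0 : 0 < (ecurrentSum (fun _ : G.edgeFinset => β) ∅).toReal :=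
    ENNReal.toReal_pos (ecurrentSum_empty_ne_zero _) (hZtop ∅)
  have keyR : M.toReal * (ecurrentSum (fun _ : G.edgeFinset => β) ∅).toReal ^ 2 ≤
      (ecurrentSum (fun _ : G.edgeFinset => β) ({a} ∆ {c})).toReal ^ 2 *
        (ecurrentSum (fun _ : G.edgeFinset => β) ({b} ∆ {e})).toReal ^ 2 := by
    have h := ENNReal.toReal_mono
      (ENNReal.mul_ne_top (ENNReal.pow_ne_top (hZtop _)) (ENNReal.pow_ne_top (hZtop _))) key
    simpa only [ENNReal.toReal_mul, ENNReal.toReal_pow] using h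
  rw [ENNReal.toReal_div, ENNReal.toReal_mul, div_pow, div_pow, div_mul_div_comm,
    div_le_div_iff₀ (mul_pos hr0 hr0) (by positivity)]
  calc M.toReal * ((ecurrentSum (fun _ : G.edgeFinset => β) ∅).toReal ^ 2 *
        (ecurrentSum (fun _ : G.edgeFinset => β) ∅).toReal ^ 2)
      = M.toReal * (ecurrentSum (fun _ : G.edgeFinset => β) ∅).toReal ^ 2 *
          ((ecurrentSum (fun _ : G.edgeFinset => β) ∅).toReal *
            (ecurrentSum (fun _ : G.edgeFinset => β) ∅).toReal) := by ring
    _ ≤ (ecurrentSum (fun _ : G.edgeFinset => β) ({a} ∆ {c})).toReal ^ 2 *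
          (ecurrentSum (fun _ : G.edgeFinset => β) ({b} ∆ {e})).toReal ^ 2 *
          ((ecurrentSum (fun _ : G.edgeFinset => β) ∅).toReal *
            (ecurrentSum (fun _ : G.edgeFinset => β) ∅).toReal) :=
        mul_le_mul_of_nonneg_right keyR (mul_pos hr0 hr0).le

end Core

/-- **Disjoint-clusters (BK-type) inequality for the sourceless double-current trace** (registered
stub `stub_disjointClustersBK` of line `xor-cluster-sign-bk`; free box `Λ_L ⊂ ℤ^d`, `β ≥ 0`):
`P^{∅,∅}_{Λ_L,β}[a ↔ c, b ↔ e, a ↮ b] ≤ ⟨σ_aσ_c⟩²_{Λ_L} ⟨σ_bσ_e⟩²_{Λ_L}`.  The finite-graph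
inequality `doubleCurrentMeasure_real_sepConn_le` for the free box graph, transported along the
lifted trace (`sourcedDoubleCurrentLaw_apply`, `sourcedTrace_preimage_openConn`) and the box
dictionary `isingTwoPoint_free_box_eq_boxGraph`.
(Aizenman–Duminil-Copin 2021, Appendix A.1, Lemma A.1; §6.2, (6.12).) -/
theorem stub_disjointClustersBK : ∀ (d L : ℕ) (β : ℝ), 0 ≤ β → ∀ a b c e : Site d,
    a ∈ box d L → b ∈ box d L → c ∈ box d L → e ∈ box d L →
    (sourcedDoubleCurrentLaw d L β ∅ ∅).real (openConn a c ∩ openConn b e ∩ (openConn a b)ᶜ) ≤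
      isingTwoPoint (zdGraph d) (box d L) β 0 .free a c ^ 2 *
        isingTwoPoint (zdGraph d) (box d L) β 0 .free b e ^ 2 := by
  intro d L β hβ a b c e ha hb hc he
  obtain ⟨a, rfl⟩ : ∃ a' : BoxVertex d L, (a' : Site d) = a := ⟨⟨a, box_subset_box_succ d L ha⟩, rfl⟩
  obtain ⟨b, rfl⟩ : ∃ b' : BoxVertex d L, (b' : Site d) = b := ⟨⟨b, box_subset_box_succ d L hb⟩, rfl⟩
  obtain ⟨c, rfl⟩ : ∃ c' : BoxVertex d L, (c' : Site d) = c := ⟨⟨c, box_subset_box_succ d L hc⟩, rfl⟩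
  obtain ⟨e, rfl⟩ : ∃ e' : BoxVertex d L, (e' : Site d) = e := ⟨⟨e, box_subset_box_succ d L he⟩, rfl⟩
  have hS : MeasurableSet (openConn (a : Site d) (c : Site d) ∩ openConn (b : Site d) (e : Site d) ∩
      (openConn (a : Site d) (b : Site d))ᶜ : Set (BondConfig (Site d))) :=
    ((measurableSet_openConn_holds _ _).inter (measurableSet_openConn_holds _ _)).inter
      (measurableSet_openConn_holds _ _).compl
  rw [measureReal_def, sourcedDoubleCurrentLaw_apply L β ∅ ∅ hS, boxSources_empty, Set.preimage_inter,
    Set.preimage_inter, Set.preimage_compl, sourcedTrace_preimage_openConn,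
    sourcedTrace_preimage_openConn, sourcedTrace_preimage_openConn, ← measureReal_def,
    isingTwoPoint_free_box_eq_boxGraph d L β a c ha hc, isingTwoPoint_free_box_eq_boxGraph d L β b e hb he]
  exact doubleCurrentMeasure_real_sepConn_le (freeBoxGraph d L) hβ a b c e

end Summit.CriticalPhenomena.Ising3DConformalLimit.ArmHyperscalingMergingFloorXor
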